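import Mathlib
import Summits.Ventures.PercRepro2.HCov
import Summits.Ventures.PercRepro2.GcHalfCount

/-!
# The pattern-law form: `Gc` depends on the instance only through the law of the partition of
the five marks (blind cell PercRepro2, typer-1 g58)

Every mass of the covariance form is the probability of an event described by the connections
among the five marks `o, a₁, a₂, a₃, b` (indices `0, …, 4`). So `Gc` is a function of the LAW OF
THE CONNECTIVITY PATTERN of the marks — the random equivalence relation `i ∼ j ⟺ mark i ↔ mark j`
— and nothing else about the instance:

* **`Pat.pat ends o a₁ a₂ a₃ b ω : Fin 5 → Fin 5 → Bool`** — the pattern of a configuration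
  (`pat_self`, `pat_symm`, `pat_trans`: an equivalence relation, so the law lives on the `Bell(5) = 52`
  partitions of the marks);
* the eight BASE pattern sets `SQ, SPD, ST, ST', Sc10, Sc20, Sc14, Sc24` and **`Pat.GcPat ν`** — the
  cubic form of `Gc` with a set function `ν` on PATTERN SETS in place of `prob p` on events;
* **`GcOf_eq_GcPat`**: `GcOf μ … = GcPat (S ↦ μ (pat ⁻¹' S))` for every set function `μ`, hence
  **`Gc_eq_GcPat`**: `Gc p ends … = GcPat (S ↦ P_p(pat ∈ S))` and **`Gc_eq_of_patLaw_eq`** — two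
  instances on ANY types with the same pattern law have the same `Gc`;
* at `p ≡ ½`: **`GcZ_eq_GcPat_patCnt`** — the integer form is the cubic `GcPat` of the PATTERN
  COUNTS `patCnt M = |{ω | pat ω = M}|` (summed over the patterns of each base set,
  `cnt_preimage_eq_sum_patCnt`): the crux is the non-negativity of one fixed integer cubic on the
  vector of pattern counts of any finite multigraph — the realisable pattern-count vectors are the
  whole object.

Standard axioms.
-/

namespace Summit.Ventures.PercRepro2

open CovForm Count

namespace Pat

/-! ## The pattern of a configuration -/

section Pattern

variable {V E : Type*}

/-- A connectivity pattern on the five marks (indices `0 = o, 1 = a₁, 2 = a₂, 3 = a₃, 4 = b`). -/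
abbrev Pattern : Type := Fin 5 → Fin 5 → Bool

/-- The five marks as a vector. -/
def marks (o a₁ a₂ a₃ b : V) : Fin 5 → V := ![o, a₁, a₂, a₃, b]

open Classical in
/-- The connectivity pattern of the configuration `ω` on the five marks. -/
noncomputable def pat (ends : E → Sym2 V) (o a₁ a₂ a₃ b : V) (ω : Config E) : Pattern :=
  fun i j => decide (Conn ends ω (marks o a₁ a₂ a₃ b i) (marks o a₁ a₂ a₃ b j))

/-- The pattern entry is the connection between the marks. -/
lemma pat_apply (ends : E → Sym2 V) (o a₁ a₂ a₃ b : V) (ω : Config E) (i j : Fin 5) :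
    pat ends o a₁ a₂ a₃ b ω i j = true ↔
      Conn ends ω (marks o a₁ a₂ a₃ b i) (marks o a₁ a₂ a₃ b j) := by
  simp [pat]

/-- A pattern is reflexive. -/
lemma pat_self (ends : E → Sym2 V) (o a₁ a₂ a₃ b : V) (ω : Config E) (i : Fin 5) :
    pat ends o a₁ a₂ a₃ b ω i i = true :=
  (pat_apply ends o a₁ a₂ a₃ b ω i i).2 (conn_refl ends ω _)

/-- A pattern is symmetric. -/
lemma pat_symm (ends : E → Sym2 V) (o a₁ a₂ a₃ b : V) (ω : Config E) (i j : Fin 5) :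
    pat ends o a₁ a₂ a₃ b ω i j = pat ends o a₁ a₂ a₃ b ω j i := by
  by_cases h : Conn ends ω (marks o a₁ a₂ a₃ b i) (marks o a₁ a₂ a₃ b j)
  · rw [(pat_apply ends o a₁ a₂ a₃ b ω i j).2 h, (pat_apply ends o a₁ a₂ a₃ b ω j i).2 (conn_symm h)]
  · have h' : ¬ Conn ends ω (marks o a₁ a₂ a₃ b j) (marks o a₁ a₂ a₃ b i) := fun hc => h (conn_symm hc)
    simp [pat, h, h']

/-- A pattern is transitive. -/
lemma pat_trans (ends : E → Sym2 V) (o a₁ a₂ a₃ b : V) (ω : Config E) {i j k : Fin 5}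
    (hij : pat ends o a₁ a₂ a₃ b ω i j = true) (hjk : pat ends o a₁ a₂ a₃ b ω j k = true) :
    pat ends o a₁ a₂ a₃ b ω i k = true :=
  (pat_apply ends o a₁ a₂ a₃ b ω i k).2
    (conn_trans ((pat_apply ends o a₁ a₂ a₃ b ω i j).1 hij) ((pat_apply ends o a₁ a₂ a₃ b ω j k).1 hjk))

end Pattern

/-! ## The base pattern sets -/

section Base

/-- `Q = {a₁ ↮ a₂}` as a pattern set. -/
def SQ : Set Pattern := {M | M 2 1 = false}

/-- `PD = {a₁ ↮ a₂, a₃ ∉ U}` as a pattern set. -/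
def SPD : Set Pattern := {M | M 1 2 = false ∧ M 3 1 = false ∧ M 3 2 = false}

/-- `T = {a₂ ↮ a₁, a₂ ↔ a₃}` as a pattern set. -/
def ST : Set Pattern := {M | M 2 1 = false ∧ M 2 3 = true}

/-- `T′ = {a₁ ↮ a₂, a₁ ↔ a₃}` as a pattern set. -/
def ST' : Set Pattern := {M | M 1 2 = false ∧ M 1 3 = true}

/-- `{a₁ ↔ o}` as a pattern set. -/
def Sc10 : Set Pattern := {M | M 1 0 = true}

/-- `{a₂ ↔ o}` as a pattern set. -/
def Sc20 : Set Pattern := {M | M 2 0 = true}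

/-- `{a₁ ↔ b}` as a pattern set. -/
def Sc14 : Set Pattern := {M | M 1 4 = true}

/-- `{a₂ ↔ b}` as a pattern set. -/
def Sc24 : Set Pattern := {M | M 2 4 = true}

variable {V E : Type*} (ends : E → Sym2 V) (o a₁ a₂ a₃ b : V)

/-- The pattern event of `SQ` is `Q`. -/
lemma preimage_SQ : pat ends o a₁ a₂ a₃ b ⁻¹' SQ = avoidAll ends a₂ {a₁} := by
  ext ω
  simp [pat, SQ, marks, avoidAll]

/-- The pattern event of `SPD` is `PD`. -/
lemma preimage_SPD : pat ends o a₁ a₂ a₃ b ⁻¹' SPD = PDEvent ends a₁ a₂ a₃ := by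
  ext ω
  simp [pat, SPD, marks, PDEvent, Dtilde, UnionCluster.inU]

/-- The pattern event of `ST` is `T`. -/
lemma preimage_ST : pat ends o a₁ a₂ a₃ b ⁻¹' ST = TEvent ends a₁ a₂ a₃ := by
  ext ω
  simp [pat, ST, marks, TEvent]

/-- The pattern event of `ST'` is `T′`. -/
lemma preimage_ST' : pat ends o a₁ a₂ a₃ b ⁻¹' ST' = TEvent ends a₂ a₁ a₃ := by
  ext ω
  simp [pat, ST', marks, TEvent]

/-- The pattern event of `Sc10` is `{a₁ ↔ o}`. -/
lemma preimage_Sc10 : pat ends o a₁ a₂ a₃ b ⁻¹' Sc10 = connEvent ends a₁ o := by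
  ext ω
  simp [pat, Sc10, marks]

/-- The pattern event of `Sc20` is `{a₂ ↔ o}`. -/
lemma preimage_Sc20 : pat ends o a₁ a₂ a₃ b ⁻¹' Sc20 = connEvent ends a₂ o := by
  ext ω
  simp [pat, Sc20, marks]

/-- The pattern event of `Sc14` is `{a₁ ↔ b}`. -/
lemma preimage_Sc14 : pat ends o a₁ a₂ a₃ b ⁻¹' Sc14 = connEvent ends a₁ b := by
  ext ω
  simp [pat, Sc14, marks]

/-- The pattern event of `Sc24` is `{a₂ ↔ b}`. -/
lemma preimage_Sc24 : pat ends o a₁ a₂ a₃ b ⁻¹' Sc24 = connEvent ends a₂ b := by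
  ext ω
  simp [pat, Sc24, marks]

end Base

/-! ## The cubic form on pattern sets -/

section Form

variable {R : Type*} [CommRing R]

/-- **The cubic form of `Gc` on pattern sets**: the thirty events of `Count.GcOf` written as
intersections of the eight base pattern sets. -/
def GcPat (ν : Set Pattern → R) : R :=
  ν SQ * (ν SPD * (ν (SQ ∩ (Sc10 ∩ Sc14)) + ν (SQ ∩ (Sc20 ∩ Sc24)) - ν (SQ ∩ (Sc20 ∩ Sc14)) -
        ν (SQ ∩ (Sc10 ∩ Sc24))) +
      (ν (SPD ∩ Sc10) + ν (SPD ∩ Sc20)) *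
        (ν (ST' ∩ Sc14) + ν (ST ∩ Sc24) - ν (ST ∩ Sc14) - ν (ST' ∩ Sc24)) -
      ν SPD * (ν (ST' ∩ (Sc10 ∩ Sc14)) + ν (ST' ∩ (Sc20 ∩ Sc14)) + ν (ST ∩ (Sc10 ∩ Sc24)) +
        ν (ST ∩ (Sc20 ∩ Sc24)) - ν (ST ∩ (Sc10 ∩ Sc14)) - ν (ST ∩ (Sc20 ∩ Sc14)) -
        ν (ST' ∩ (Sc10 ∩ Sc24)) - ν (ST' ∩ (Sc20 ∩ Sc24)))) +
    (ν Sc24 - ν Sc14) *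
      (ν SPD * (ν (SQ ∩ Sc10) - ν (SQ ∩ Sc20)) +
        (ν (SPD ∩ Sc10) + ν (SPD ∩ Sc20)) * (ν ST' - ν ST) -
        ν SPD * (ν (ST' ∩ Sc10) + ν (ST' ∩ Sc20) - ν (ST ∩ Sc10) - ν (ST ∩ Sc20))) +
    ν SQ * ((ν (SPD ∩ Sc10) + ν (SPD ∩ Sc20)) * (ν (SPD ∩ Sc14) + ν (SPD ∩ Sc24)) -
      ν SPD * (ν (SPD ∩ (Sc10 ∩ Sc14)) + ν (SPD ∩ (Sc20 ∩ Sc14)) + ν (SPD ∩ (Sc10 ∩ Sc24)) +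
        ν (SPD ∩ (Sc20 ∩ Sc24))))

variable {V E : Type*} (ends : E → Sym2 V) (o a₁ a₂ a₃ b : V)

/-- **The cubic form of `Gc` is the cubic form on pattern sets at the pattern law**: for every set
function `μ` on events, `GcOf μ … = GcPat (S ↦ μ (pat ⁻¹' S))`. -/
theorem GcOf_eq_GcPat (μ : Set (Config E) → R) :
    GcOf μ ends o a₁ a₂ a₃ b = GcPat (fun S => μ (pat ends o a₁ a₂ a₃ b ⁻¹' S)) := by
  simp only [GcOf, DEFOf, EQboOf, EQb3Of, EQb3oOf, EQoOf, EQ3Of, EQ3oOf, PDbOf, PDboOf, DoOf,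
    gapOf, GcPat, Set.preimage_inter, preimage_SQ, preimage_SPD, preimage_ST, preimage_ST',
    preimage_Sc10, preimage_Sc20, preimage_Sc14, preimage_Sc24]

end Form

/-! ## `Gc` depends only on the pattern law -/

section Law

variable {V E : Type*} [Fintype E] [DecidableEq E] {R : Type*} [Field R]

/-- **`Gc` is a function of the pattern law** `S ↦ P_p(pat ∈ S)`. -/
theorem Gc_eq_GcPat (p : E → R) (ends : E → Sym2 V) (o a₁ a₂ a₃ b : V) :
    Gc p ends o a₁ a₂ a₃ b = GcPat (fun S => prob p (pat ends o a₁ a₂ a₃ b ⁻¹' S)) := by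
  rw [Gc_eq_GcOf, GcOf_eq_GcPat]

/-- **Two instances (on any types) with the same pattern law have the same `Gc`.** -/
theorem Gc_eq_of_patLaw_eq {V' E' : Type*} [Fintype E'] [DecidableEq E'] (p : E → R)
    (ends : E → Sym2 V) (o a₁ a₂ a₃ b : V) (p' : E' → R) (ends' : E' → Sym2 V')
    (o' a₁' a₂' a₃' b' : V')
    (h : ∀ S : Set Pattern, prob p (pat ends o a₁ a₂ a₃ b ⁻¹' S) =
      prob p' (pat ends' o' a₁' a₂' a₃' b' ⁻¹' S)) :
    Gc p ends o a₁ a₂ a₃ b = Gc p' ends' o' a₁' a₂' a₃' b' := by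
  rw [Gc_eq_GcPat, Gc_eq_GcPat]
  exact congrArg GcPat (funext h)

end Law

/-! ## Pattern counts at `p ≡ ½` -/

section Counts

variable {V E : Type*} [Fintype E] [DecidableEq E] (ends : E → Sym2 V) (o a₁ a₂ a₃ b : V)

open Classical in
/-- The number of configurations with the pattern `M`. -/
noncomputable def patCnt (M : Pattern) : ℕ := cnt (pat ends o a₁ a₂ a₃ b ⁻¹' {M})

open Classical in
/-- The count of a pattern event is the sum of the pattern counts over its patterns. -/
lemma cnt_preimage_eq_sum_patCnt (S : Set Pattern) :
    cnt (pat ends o a₁ a₂ a₃ b ⁻¹' S) =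
      ∑ M ∈ Finset.univ.filter (· ∈ S), patCnt ends o a₁ a₂ a₃ b M := by
  unfold cnt patCnt
  rw [Finset.card_eq_sum_card_fiberwise (f := pat ends o a₁ a₂ a₃ b)
    (t := Finset.univ.filter (· ∈ S))]
  · refine Finset.sum_congr rfl fun M hM => ?_
    have hMS : M ∈ S := by simpa using hM
    congr 1
    ext ω
    simp
    intro h
    rw [h]
    exact hMS
  · intro ω hω
    simp only [Finset.coe_filter, Finset.mem_univ, true_and, Set.mem_setOf_eq,
      Set.mem_preimage] at hω
    simp [hω]

open Classical in
/-- **The integer form is the cubic form of the pattern counts**: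
`GcZ = GcPat (S ↦ ∑_{M ∈ S} patCnt M)`. -/
theorem GcZ_eq_GcPat_patCnt :
    GcZ ends o a₁ a₂ a₃ b =
      GcPat (fun S => ∑ M ∈ Finset.univ.filter (· ∈ S), (patCnt ends o a₁ a₂ a₃ b M : ℤ)) := by
  rw [GcZ, GcOf_eq_GcPat]
  congr 1
  funext S
  rw [cnt_preimage_eq_sum_patCnt]
  push_cast
  rfl

end Counts

end Pat

end Summit.Ventures.PercRepro2
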